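import Mathlib

/-!
# The co-star injection: an explicit proof of (MS2) whenever a minimal member has distinct traces (hp-7 gen 76)

Support file for crux `stmt-CriticalPhenomena-4575` (route `PercNearOneGluingNoHeavy`), hull-port seat `prim-hp-7`
(generation 76); `--supports stmt-CriticalPhenomena-4575`.  No `sorry`.  Memo:
`run/shared/lean/prim/prim-hp-7/FROM-prim-hp-7-g76-ORDER-CERTIFICATES.md` §9.

The second-order Marica–Schönheim conjecture (`GeneratedDonors.MS2`, file `…HexMSMatchMS2`) asks, for a two-coloured family
`F = P ⊔ Q` with designated cross differences `D₅ ⊆ P \\ Q`, `D₂ ⊆ Q \\ P`, that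
`#(F ∪ D₅ ∪ D₂) ≤ #(F \\ F ∪ P \\ D₅ ∪ Q \\ D₂)`.  This file proves it by an EXPLICIT INJECTION in the (frequent) case that some member
`p ∈ F` separates the family by traces: `g ↦ g \ p` is injective on `F` (so `p` is `⊆`-minimal and the other members have pairwise
distinct traces outside `p`).  Then

* every member `g` is sent to the difference `g \ p` (`p` itself to `∅`) — the **co-star** of `p`;
* every designated difference outside the co-star is sent to itself;
* a designated difference IN the co-star, `d = g \ p` (its member `g` is unique), is sent to its **corner** `g \ d = g ∩ p`, a second
  difference of the right block (`g ∈ P` if `d ∈ D₅`, `g ∈ Q` if `d ∈ D₂` — forced by purity once reverse representations are excluded).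

`CoStar.ms2_of_coStarCert` is the general form (any reserved map `τ` on the designated sets that is injective, lands in the term set and
avoids the co-star); `CoStar.ms2_of_coStar` is the corner rule under the explicit hypotheses that distinct designated co-star elements
have distinct nonempty corners and that no corner is itself designated.  Numerically (memo §9; dead-like depth-one configurations of
the (MATCH*) programme, `n = 4..7`, 3 000 each) the corner rule applies to 75 / 72 / 77 / 85 % of all configurations — including most
TWO-TYPE ones, which no earlier uniform theorem reached — and together with `…HexMSMatchPureSCTight` (tight-or-free) and
`…HexMSMatchTopsSuffice` (one type, no cross containment) covers 100 / 98.4 / 99.5 / 99.9 %.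
-/

namespace Summit.CriticalPhenomena.PercolationContinuityZ3.Theorems

namespace CoStar

open Finset
open scoped FinsetFamily

variable {α : Type*} [DecidableEq α]

/-- **Co-star certificates** (hp-7 gen 76).  Let `p ∈ F = P ∪ Q` be a member such that `g ↦ g \ p` is injective on `F`, and let `τ` be
a map on the designated sets `D₅ ∪ D₂`, injective, with values in `T = F \\ F ∪ P \\ D₅ ∪ Q \\ D₂`, none of which is a trace `g \ p`
(`g ∈ F`).  Then `#(F ∪ D₅ ∪ D₂) ≤ #T`: the map `g ↦ g \ p` on members, `τ` on the other designated sets, is an injection into `T`. -/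
theorem ms2_of_coStarCert (P Q D₅ D₂ : Finset (Finset α)) (p : Finset α) (hp : p ∈ P ∪ Q)
    (hinj : Set.InjOn (fun g => g \ p) ↑(P ∪ Q)) (τ : Finset α → Finset α)
    (hτT : ∀ d ∈ D₅ ∪ D₂, τ d ∈ ((P ∪ Q) \\ (P ∪ Q)) ∪ (P \\ D₅) ∪ (Q \\ D₂))
    (hτinj : Set.InjOn τ ↑(D₅ ∪ D₂)) (hτco : ∀ d ∈ D₅ ∪ D₂, ∀ g ∈ P ∪ Q, τ d ≠ g \ p) :
    #((P ∪ Q) ∪ D₅ ∪ D₂) ≤ #(((P ∪ Q) \\ (P ∪ Q)) ∪ (P \\ D₅) ∪ (Q \\ D₂)) := by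
  classical
  set F := P ∪ Q with hFdef
  set D := D₅ ∪ D₂ with hDdef
  set T := (F \\ F) ∪ (P \\ D₅) ∪ (Q \\ D₂) with hTdef
  have h1 : (P ∪ Q) ∪ D₅ ∪ D₂ = F ∪ D := by rw [hDdef, union_assoc]
  rw [h1]
  let Φ : Finset α → Finset α := fun x => if x ∈ F then x \ p else τ x
  refine card_le_card_of_injOn Φ ?_ ?_
  · -- `Φ` maps `F ∪ D` into `T`
    intro x hx
    have hx' : x ∈ F ∪ D := hx
    show Φ x ∈ (T : Set (Finset α))
    rcases mem_union.mp hx' with hxF | hxD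
    · simp only [Φ, if_pos hxF]
      exact mem_union_left _ (mem_union_left _ (mem_diffs.mpr ⟨x, hxF, p, hp, rfl⟩))
    · by_cases hxF : x ∈ F
      · simp only [Φ, if_pos hxF]
        exact mem_union_left _ (mem_union_left _ (mem_diffs.mpr ⟨x, hxF, p, hp, rfl⟩))
      · simp only [Φ, if_neg hxF]
        exact hτT x hxD
  · -- `Φ` is injective on `F ∪ D`
    intro x hx y hy hxy
    have hx' : x ∈ F ∪ D := hx
    have hy' : y ∈ F ∪ D := hy
    by_cases hxF : x ∈ F <;> by_cases hyF : y ∈ F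
    · have : x \ p = y \ p := by simpa [Φ, hxF, hyF] using hxy
      exact hinj hxF hyF this
    · have hyD : y ∈ D := (mem_union.mp hy').resolve_left hyF
      have : x \ p = τ y := by simpa [Φ, hxF, hyF] using hxy
      exact absurd this.symm (hτco y hyD x hxF)
    · have hxD : x ∈ D := (mem_union.mp hx').resolve_left hxF
      have : τ x = y \ p := by simpa [Φ, hxF, hyF] using hxy
      exact absurd this (hτco x hxD y hyF)
    · have hxD : x ∈ D := (mem_union.mp hx').resolve_left hxF
      have hyD : y ∈ D := (mem_union.mp hy').resolve_left hyF
      have : τ x = τ y := by simpa [Φ, hxF, hyF] using hxy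
      exact hτinj hxD hyD this

/-- **(MS2) by the co-star injection with corners** (hp-7 gen 76).  Hypotheses: `D₅ ⊆ P \\ Q` and `D₂ ⊆ Q \\ P` are pure (no designated
set is a difference inside a block) with no reverse representations (`D₅ ∩ Q \\ P = ∅ = D₂ ∩ P \\ Q`); some member `p` has `g ↦ g \ p`
injective on `F = P ∪ Q`; the designated traces `g \ p ∈ D₅ ∪ D₂` have nonempty, pairwise distinct corners `g ∩ p`, none of which is itself
designated.  Then `#(F ∪ D₅ ∪ D₂) ≤ #(F \\ F ∪ P \\ D₅ ∪ Q \\ D₂)`.  (Members `g ↦ g \ p`; designated `g \ p ↦ g ∩ p = g \ (g \ p)`, a second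
difference of the right block; other designated sets to themselves.) -/
theorem ms2_of_coStar (P Q D₅ D₂ : Finset (Finset α)) (hD₅ : D₅ ⊆ P \\ Q) (hD₂ : D₂ ⊆ Q \\ P)
    (hpure : ∀ d ∈ D₅ ∪ D₂, d ∉ (P \\ P) ∪ (Q \\ Q))
    (hrev₅ : ∀ d ∈ D₅, d ∉ Q \\ P) (hrev₂ : ∀ d ∈ D₂, d ∉ P \\ Q)
    (p : Finset α) (hp : p ∈ P ∪ Q) (hinj : Set.InjOn (fun g => g \ p) ↑(P ∪ Q))
    (hne : ∀ g ∈ P ∪ Q, g \ p ∈ D₅ ∪ D₂ → (g ∩ p).Nonempty)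
    (hcor : ∀ g ∈ P ∪ Q, ∀ g' ∈ P ∪ Q, g \ p ∈ D₅ ∪ D₂ → g' \ p ∈ D₅ ∪ D₂ → g ∩ p = g' ∩ p → g = g')
    (hcid : ∀ g ∈ P ∪ Q, g \ p ∈ D₅ ∪ D₂ → g ∩ p ∉ D₅ ∪ D₂) :
    #((P ∪ Q) ∪ D₅ ∪ D₂) ≤ #(((P ∪ Q) \\ (P ∪ Q)) ∪ (P \\ D₅) ∪ (Q \\ D₂)) := by
  classical
  set F := P ∪ Q with hFdef
  set D := D₅ ∪ D₂ with hDdef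
  -- the unique member with a given trace
  let G : Finset α → Finset (Finset α) := fun d => F.filter fun g => g \ p = d
  have hG : ∀ {d : Finset α} {g : Finset α}, g ∈ F → g \ p = d → G d = {g} := by
    intro d g hg hgd
    ext x
    simp only [G, mem_filter, mem_singleton]
    constructor
    · rintro ⟨hx, hxd⟩
      exact hinj hx hg (hxd.trans hgd.symm)
    · rintro rfl
      exact ⟨hg, hgd⟩
  -- the reserved map: corner for designated traces, identity otherwise
  let τ : Finset α → Finset α := fun d => if (G d).Nonempty then (G d).sup id ∩ p else d
  have hτ_costar : ∀ {d g : Finset α}, g ∈ F → g \ p = d → τ d = g ∩ p := by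
    intro d g hg hgd
    have hGd : G d = {g} := hG hg hgd
    have hne' : (G d).Nonempty := by rw [hGd]; exact singleton_nonempty g
    simp only [τ, if_pos hne', hGd, sup_singleton, id_eq]
  have hτ_id : ∀ {d : Finset α}, (∀ g ∈ F, g \ p ≠ d) → τ d = d := by
    intro d hd
    have hempty : ¬ (G d).Nonempty := by
      rintro ⟨g, hg⟩
      obtain ⟨hgF, hgd⟩ := mem_filter.mp hg
      exact hd g hgF hgd
    simp only [τ, if_neg hempty]
  -- a designated trace `g \ p` lies in the block prescribed by its type
  have hblock₅ : ∀ {g : Finset α}, g ∈ F → g \ p ∈ D₅ → g ∈ P := by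
    intro g hg hgd
    rcases mem_union.mp hg with hgP | hgQ
    · exact hgP
    · exfalso
      rcases mem_union.mp hp with hpP | hpQ
      · exact hrev₅ _ hgd (mem_diffs.mpr ⟨g, hgQ, p, hpP, rfl⟩)
      · exact hpure _ (mem_union_left _ hgd) (mem_union_right _ (mem_diffs.mpr ⟨g, hgQ, p, hpQ, rfl⟩))
  have hblock₂ : ∀ {g : Finset α}, g ∈ F → g \ p ∈ D₂ → g ∈ Q := by
    intro g hg hgd
    rcases mem_union.mp hg with hgP | hgQ
    · exfalso
      rcases mem_union.mp hp with hpP | hpQ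
      · exact hpure _ (mem_union_right _ hgd) (mem_union_left _ (mem_diffs.mpr ⟨g, hgP, p, hpP, rfl⟩))
      · exact hrev₂ _ hgd (mem_diffs.mpr ⟨g, hgP, p, hpQ, rfl⟩)
    · exact hgQ
  have hcorner : ∀ (g : Finset α), g \ (g \ p) = g ∩ p := fun g => by
    rw [sdiff_sdiff_right_self]
    rfl
  refine ms2_of_coStarCert P Q D₅ D₂ p hp hinj τ ?_ ?_ ?_
  · -- values in `T`
    intro d hd
    by_cases hex : ∃ g ∈ F, g \ p = d
    · obtain ⟨g, hg, hgd⟩ := hex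
      rw [hτ_costar hg hgd, ← hcorner g, hgd]
      rcases mem_union.mp hd with hd5 | hd2
      · exact mem_union_left _ (mem_union_right _
          (mem_diffs.mpr ⟨g, hblock₅ hg (hgd ▸ hd5), d, hd5, rfl⟩))
      · exact mem_union_right _ (mem_diffs.mpr ⟨g, hblock₂ hg (hgd ▸ hd2), d, hd2, rfl⟩)
    · push Not at hex
      rw [hτ_id hex]
      rcases mem_union.mp hd with hd5 | hd2
      · obtain ⟨a, ha, b, hb, rfl⟩ := mem_diffs.mp (hD₅ hd5)
        exact mem_union_left _ (mem_union_left _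
          (mem_diffs.mpr ⟨a, mem_union_left _ ha, b, mem_union_right _ hb, rfl⟩))
      · obtain ⟨a, ha, b, hb, rfl⟩ := mem_diffs.mp (hD₂ hd2)
        exact mem_union_left _ (mem_union_left _
          (mem_diffs.mpr ⟨a, mem_union_right _ ha, b, mem_union_left _ hb, rfl⟩))
  · -- injectivity of `τ` on the designated sets
    intro d hd d' hd' hdd
    have hdD : d ∈ D := hd
    have hdD' : d' ∈ D := hd'
    by_cases hex : ∃ g ∈ F, g \ p = d <;> by_cases hex' : ∃ g ∈ F, g \ p = d'
    · obtain ⟨g, hg, hgd⟩ := hex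
      obtain ⟨g', hg', hgd'⟩ := hex'
      rw [hτ_costar hg hgd, hτ_costar hg' hgd'] at hdd
      have := hcor g hg g' hg' (hgd ▸ hdD) (hgd' ▸ hdD') hdd
      rw [← hgd, ← hgd', this]
    · obtain ⟨g, hg, hgd⟩ := hex
      push Not at hex'
      rw [hτ_costar hg hgd, hτ_id hex'] at hdd
      exact absurd (hdd ▸ hdD') (hcid g hg (hgd ▸ hdD))
    · obtain ⟨g', hg', hgd'⟩ := hex'
      push Not at hex
      rw [hτ_id hex, hτ_costar hg' hgd'] at hdd
      exact absurd (hdd ▸ hdD) (hcid g' hg' (hgd' ▸ hdD'))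
    · push Not at hex hex'
      rwa [hτ_id hex, hτ_id hex'] at hdd
  · -- no value of `τ` is a trace
    intro d hd g hg heq
    have hdD : d ∈ D := hd
    by_cases hex : ∃ g' ∈ F, g' \ p = d
    · obtain ⟨g', hg', hgd'⟩ := hex
      rw [hτ_costar hg' hgd'] at heq
      -- `g' ∩ p ⊆ p` but `g \ p` is disjoint from `p`: both empty
      obtain ⟨x, hx⟩ := hne g' hg' (hgd' ▸ hdD)
      have hxp : x ∈ p := (mem_inter.mp hx).2
      have : x ∈ g \ p := heq ▸ hx
      exact (mem_sdiff.mp this).2 hxp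
    · push Not at hex
      rw [hτ_id hex] at heq
      exact hex g hg heq.symm

end CoStar

end Summit.CriticalPhenomena.PercolationContinuityZ3.Theorems
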